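import Literature.AnabelianGeometry.SemiGraphs.TemperedSpecialFibreInertiaTransport
import Literature.AnabelianGeometry.SemiGraphs.TemperedSpecialFibreReductionsDescended
import Literature.AnabelianGeometry.SemiGraphs.TemperedSpecialFibreCuspExtension
import HarnessLib

/-!
# [SemiAnbd] Cor. 3.11 from the steps of its printed proof, with (S2) CUT into its geometric sentences

Mochizuki, *Semi-graphs of anabelioids*, Publ. RIMS **42** (2006), §3, Corollary 3.11 and its proof,
manuscript pp. 45–49 [cite: MochizukiSemiAnbd2006, Cor 3.11 pp.45-49]: "we obtain that `p_α = p_β`" (p. 48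
l. 23–24) — via the inertia groups `I_v ⊆ D_v ⊆ Δ[□]/Δ′[□]` (p. 48 l. 9–23).

PROOF-ONLY file (abc-iut cell, layer L3, sub-DAG `plan/L3/SUBDAG-SemiAnbd-Cor311.md` rows A/S2; seat
abc-iut-L3-t11 gen 4, L3-lead α106).  The assemblies `corollary_3_11_of_steps'` (abc-iut-w4-d058,
`TemperedSpecialFibreReductionsDescended.lean`) and `corollary_3_11_of_steps_cuspBranches` (abc-iut-w4-d083,
`TemperedSpecialFibreCuspExtension.lean`: (S3′) DERIVED from the cusp-branch matching `CuspBranchesPreserved`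
and the finiteness of the certified special fibres) take (S2) `ResidueCharOfTemperedIso` whole; here (S2)
is replaced by its printed ingredients (S2a) `InertiaOrdersPrimePow Σ p_□ Ω_□` (both sides) and (S2b)
`HasNontrivialInertia Σ Ω_α` (`TemperedSpecialFibreInertia.lean`), through the PROVED reduction
`residueCharOfTemperedIso_of_inertia` (`TemperedSpecialFibreInertiaTransport.lean`):

* `corollary_3_11_of_steps_inertia` — `Cor311 ⇐ (S1) ∧ (S2a)×2 ∧ (S2b) ∧ (S3′)`;
* `corollary_3_11_of_cuts` — `Cor311 ⇐ finiteness ∧ (S1) ∧ (S2a)×2 ∧ (S2b) ∧ CuspBranchesPreserved`: the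
  residual of [SemiAnbd] Cor. 3.11 along the sub-DAG's path with BOTH cuts applied — every member a quoted
  sentence of the printed proof, typed over the origin hypotheses and asserted for no origin.

Nothing here takes a side on [IUTchIII] Cor. 3.12; typed ≠ proved for the residual steps.
-/

noncomputable section

namespace Literature.AnabelianGeometry.SemiGraphs

universe u

variable {Kα : Type u} [Field Kα] {Kβ : Type u} [Field Kβ]

/-- **[SemiAnbd] Cor. 3.11 from (S1), (S2a), (S2b), (S3′)** (pp. 45–49): the assembly
`corollary_3_11_of_steps'` with its step (S2) «`p_α = p_β`» supplied by `residueCharOfTemperedIso_of_inertia`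
from the two geometric sentences of p. 48 — the `p_□`-power order of the inertia groups `I_v` (S2a, at
`Ω_α` and at `Ω_β`) and the existence of a nontrivial `I_v` (S2b, at `Ω_α`) — at one set of primes `Σ` (print,
p. 46 l. 1: "`p_α, p_β ∉ Σ`"). [cite: MochizukiSemiAnbd2006, Cor 3.11 pp.45-49] -/
theorem corollary_3_11_of_steps_inertia (pα pβ : ℕ) [Fact pα.Prime] [Fact pβ.Prime] [Algebra ℚ_[pα] Kα]
    [FiniteDimensional ℚ_[pα] Kα] [Algebra ℚ_[pβ] Kβ] [FiniteDimensional ℚ_[pβ] Kβ]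
    (Ωα : SpecialFibreOrigin Kα) (Ωβ : SpecialFibreOrigin Kβ) (S : Set ℕ)
    (hS1 : AdmissibleQuotientCompatible Ωα Ωβ) (hS2a : InertiaOrdersPrimePow S pα Ωα)
    (hS2a' : InertiaOrdersPrimePow S pβ Ωβ) (hS2b : HasNontrivialInertia S Ωα)
    (hS3' : SpecialFibreIsoOfDescendedIso Ωα Ωβ) : Cor311 pα pβ Ωα Ωβ :=
  corollary_3_11_of_steps' pα pβ Ωα Ωβ hS1
    (residueCharOfTemperedIso_of_inertia pα pβ Ωα Ωβ S hS2a hS2a' hS2b) hS3'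

/-- **[SemiAnbd] Cor. 3.11 with BOTH cuts of the sub-DAG applied** (pp. 45–49): from the finiteness of the
certified special fibres, (S1) `AdmissibleQuotientCompatible` (p. 46/p. 48: the admissible quotient is
group-theoretic), (S2a) at `Ω_α`, `Ω_β` and (S2b) at `Ω_α` (p. 48: inertia orders are `p_□`-powers; some
`I_v ≠ 1`), and `CuspBranchesPreserved` (p. 47 (i)–(iv): the cusp-branch matching) — abc-iut-w4-d083's
`corollary_3_11_of_steps_cuspBranches` with (S2) supplied by `residueCharOfTemperedIso_of_inertia`.  Along
this path Cor. 3.9 (iso form), the extension along the cusps (C), (S3′), the transport of the inertia groups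
and every uniqueness clause are kernel theorems; the four named residual steps are FACT-policy.
[cite: MochizukiSemiAnbd2006, Cor 3.11 pp.45-49] -/
theorem corollary_3_11_of_cuts (pα pβ : ℕ) [Fact pα.Prime] [Fact pβ.Prime] [Algebra ℚ_[pα] Kα]
    [FiniteDimensional ℚ_[pα] Kα] [Algebra ℚ_[pβ] Kβ] [FiniteDimensional ℚ_[pβ] Kβ]
    (Ωα : SpecialFibreOrigin Kα) (Ωβ : SpecialFibreOrigin Kβ) (S : Set ℕ)
    (hfinα : ∀ (D : TemperedArithmeticGroup Kα) (Sp : SpecialFibreData D), Ωα.IsSpecialFibreOf D Sp →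
      Finite Sp.Gc.graph.Vertex ∧ Finite Sp.Gc.graph.Edge)
    (hfinβ : ∀ (D : TemperedArithmeticGroup Kβ) (Sp : SpecialFibreData D), Ωβ.IsSpecialFibreOf D Sp →
      Finite Sp.Gc.graph.Vertex ∧ Finite Sp.Gc.graph.Edge)
    (hS1 : AdmissibleQuotientCompatible Ωα Ωβ) (hS2a : InertiaOrdersPrimePow S pα Ωα)
    (hS2a' : InertiaOrdersPrimePow S pβ Ωβ) (hS2b : HasNontrivialInertia S Ωα)
    (hCB : CuspBranchesPreserved Ωα Ωβ) : Cor311 pα pβ Ωα Ωβ :=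
  corollary_3_11_of_steps_cuspBranches pα pβ Ωα Ωβ hfinα hfinβ hS1
    (residueCharOfTemperedIso_of_inertia pα pβ Ωα Ωβ S hS2a hS2a' hS2b) hCB

end Literature.AnabelianGeometry.SemiGraphs

end
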